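import Literature.NumberTheory.EllipticCurves.ModularCurveEtaQuotientsProofs
import Literature.NumberTheory.EllipticCurves.ModularFormsRamanujan
import Mathlib.NumberTheory.ModularForms.EisensteinSeries.E2.Transform
import Mathlib.NumberTheory.ModularForms.EisensteinSeries.E2.Summable
import Mathlib.NumberTheory.ModularForms.EisensteinSeries.E2.MDifferentiable
import HarnessLib

/-!
# The weight-2 Eisenstein series `E₂(τ) − δE₂(δτ)` of level `δ` as modular forms

For Mathlib's quasimodular `E₂ = EisensteinSeries.E2` (`E₂|₂γ = E₂ − (2ζ(2))⁻¹D₂(γ)`, i.e.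
`E₂(γτ) = (cτ+d)²E₂(τ) − (6ic/π)(cτ+d)`, `E2_smul_eq`) and `δ ≥ 1`, the function

  `Φ_δ(τ) := E₂(τ) − δ E₂(δτ)`     (`phiE2 δ`)

is a genuine modular form of weight `2` on `Γ₀(δ)`: the anomaly of `δE₂(δ·)` under `γ ∈ Γ₀(δ)` equals
that of `E₂` (`δ(γτ) = γ_δ(δτ)`, `γ_δ = (a, bδ; c/δ, d)`, tree's `natMul_coe_SL2_smul`), so
`Φ_δ(γτ) = (cτ+d)²Φ_δ(τ)` (`phiE2_smul`), it is holomorphic, and it is bounded at every cusp (for any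
`A ∈ SL₂(ℤ)`, `δ·Aτ = A′((gτ+m)/a′)` with `A′ ∈ SL₂(ℤ)`, `ga′ = δ`, tree's `exists_SL2_decomposition`,
and `E₂` is bounded at `i∞`). Result: `phiE2ModularForm δ : ModularForm (Gamma0 δ) 2`
(Diamond–Shurman §1.2 / Zagier §2.3: "`E₂(τ) − NE₂(Nτ) ∈ M₂(Γ₀(N))`"). These span the Eisenstein
part of `M₂(Γ₀(N))` (all of it for `N = 6`) and carry the logarithmic derivatives of `η`-quotients
(`DombEtaQuotientDerivatives.lean`).

## References

* F. Diamond, J. Shurman, *A First Course in Modular Forms*, §1.2 (p. 19: `E₂(τ) − NE₂(Nτ)`).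
  [DiamondShurman2005]
* D. Zagier, *Elliptic modular forms and their applications* (2008), §2.3. [Zagier2008]
-/

noncomputable section

open UpperHalfPlane hiding I
open Complex Filter Topology Asymptotics EisensteinSeries ModularForm
open scoped Real MatrixGroups ModularForm Manifold

open Literature.NumberTheory.EllipticCurves.ModularForms

namespace Literature.NumberTheory.ModularForms

/-! ### `E₂` under `SL₂(ℤ)` -/

/-- **`E₂(γτ) = (cτ+d)² E₂(τ) − (6ic/π)(cτ+d)`** for `γ = (a b; c d) ∈ SL₂(ℤ)` (Mathlib's
`E2_slash_action` unfolded, `ζ(2) = π²/6`). [cite: Zagier2008, §2.3] -/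
theorem E2_smul_eq (γ : SL(2, ℤ)) (τ : ℍ) :
    E2 (γ • τ) = ((γ 1 0 : ℂ) * τ + γ 1 1) ^ 2 * E2 τ -
      6 * I * (γ 1 0 : ℂ) / π * ((γ 1 0 : ℂ) * τ + γ 1 1) := by
  have h := congrFun (E2_slash_action γ) τ
  rw [SL_slash_apply, ModularGroup.denom_apply, Pi.sub_apply, Pi.smul_apply, smul_eq_mul, D2,
    ModularGroup.denom_apply, riemannZeta_two] at h
  have hj : (γ 1 0 : ℂ) * τ + γ 1 1 ≠ 0 := SL2_denom_ne_zero γ τ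
  have hπ : (π : ℂ) ≠ 0 := ofReal_ne_zero.2 Real.pi_ne_zero
  rw [zpow_neg, zpow_ofNat, mul_inv_eq_iff_eq_mul₀ (pow_ne_zero 2 hj)] at h
  rw [h]
  field_simp

/-! ### The functions `E₂(δτ)` and `Φ_δ = E₂ − δE₂(δ·)` -/

/-- `E₂(δτ)` as a function on `ℍ` (`δ ≥ 1`). [folklore] -/
def E2natMul (δ : ℕ) (hδ : 0 < δ) (τ : ℍ) : ℂ := E2 (natMulPt δ hδ τ)

/-- **`Φ_δ(τ) = E₂(τ) − δE₂(δτ)`.** [cite: DiamondShurman2005, §1.2] -/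
def phiE2 (δ : ℕ) (hδ : 0 < δ) (τ : ℍ) : ℂ := E2 τ - (δ : ℂ) * E2 (natMulPt δ hδ τ)

/-- **`E₂(δ·γτ) = (cτ+d)² E₂(δτ) − (6ic/(πδ))(cτ+d)`** for `γ ∈ Γ₀(δ)`: the anomaly of `δE₂(δ·)`
equals that of `E₂`. [cite: DiamondShurman2005, §1.2] -/
theorem E2natMul_smul (δ : ℕ) (hδ : 0 < δ) {γ : SL(2, ℤ)} (hγ : γ ∈ CongruenceSubgroup.Gamma0 δ)
    (τ : ℍ) :
    E2natMul δ hδ (γ • τ) = ((γ 1 0 : ℂ) * τ + γ 1 1) ^ 2 * E2natMul δ hδ τ -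
      6 * I * (γ 1 0 : ℂ) / (π * δ) * ((γ 1 0 : ℂ) * τ + γ 1 1) := by
  -- `c = δ c'`
  have hc0 : ((γ 1 0 : ℤ) : ZMod δ) = 0 := CongruenceSubgroup.Gamma0_mem.mp hγ
  obtain ⟨c', hc⟩ := (ZMod.intCast_zmod_eq_zero_iff_dvd _ δ).mp hc0
  have hpt : natMulPt δ hδ (γ • τ) = conjDelta γ δ c' hc • natMulPt δ hδ τ := by
    apply UpperHalfPlane.ext
    rw [coe_natMulPt]
    exact natMul_coe_SL2_smul γ δ hδ c' hc τ
  obtain ⟨_, _, h10, h11⟩ := conjDelta_apply γ δ c' hc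
  rw [E2natMul, hpt, E2_smul_eq, h10, h11, coe_natMulPt, E2natMul]
  have hcC : ((γ 1 0 : ℤ) : ℂ) = (δ : ℂ) * c' := by exact_mod_cast hc
  have hδ0 : (δ : ℂ) ≠ 0 := by exact_mod_cast hδ.ne'
  have hπ : (π : ℂ) ≠ 0 := ofReal_ne_zero.2 Real.pi_ne_zero
  rw [hcC]
  field_simp

/-- **`Φ_δ(γτ) = (cτ+d)² Φ_δ(τ)` for `γ ∈ Γ₀(δ)`.** [cite: DiamondShurman2005, §1.2] -/
theorem phiE2_smul (δ : ℕ) (hδ : 0 < δ) {γ : SL(2, ℤ)} (hγ : γ ∈ CongruenceSubgroup.Gamma0 δ)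
    (τ : ℍ) :
    phiE2 δ hδ (γ • τ) = ((γ 1 0 : ℂ) * τ + γ 1 1) ^ 2 * phiE2 δ hδ τ := by
  have h1 := E2_smul_eq γ τ
  have h2 := E2natMul_smul δ hδ hγ τ
  simp only [E2natMul] at h2
  simp only [phiE2]
  rw [h1, h2]
  have hδ0 : (δ : ℂ) ≠ 0 := by exact_mod_cast hδ.ne'
  have hπ : (π : ℂ) ≠ 0 := ofReal_ne_zero.2 Real.pi_ne_zero
  field_simp
  ring

/-- Slash-invariance: `Φ_δ ∣₂ γ = Φ_δ` for `γ ∈ Γ₀(δ)`. [cite: DiamondShurman2005, §1.2] -/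
theorem phiE2_slash (δ : ℕ) (hδ : 0 < δ) {γ : SL(2, ℤ)} (hγ : γ ∈ CongruenceSubgroup.Gamma0 δ) :
    phiE2 δ hδ ∣[(2 : ℤ)] γ = phiE2 δ hδ := by
  funext τ
  rw [SL_slash_apply, ModularGroup.denom_apply, phiE2_smul δ hδ hγ τ]
  have hj : (γ 1 0 : ℂ) * τ + γ 1 1 ≠ 0 := SL2_denom_ne_zero γ τ
  rw [zpow_neg, zpow_ofNat]
  field_simp

/-! ### Holomorphy -/

/-- `τ ↦ E₂(δτ)` is holomorphic on `ℍ`. [folklore] -/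
theorem mdifferentiable_E2natMul (δ : ℕ) (hδ : 0 < δ) : MDiff (E2natMul δ hδ) := by
  rw [UpperHalfPlane.mdifferentiable_iff]
  have hE : DifferentiableOn ℂ (E2 ∘ ofComplex) {z : ℂ | 0 < z.im} :=
    UpperHalfPlane.mdifferentiable_iff.mp E2_mdifferentiable
  have hmul : DifferentiableOn ℂ (fun z : ℂ => (δ : ℂ) * z) {z : ℂ | 0 < z.im} := by fun_prop
  have hmaps : Set.MapsTo (fun z : ℂ => (δ : ℂ) * z) {z : ℂ | 0 < z.im} {z : ℂ | 0 < z.im} := by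
    intro z hz
    simp only [Set.mem_setOf_eq] at hz ⊢
    simpa using mul_pos (Nat.cast_pos.mpr hδ) hz
  refine (hE.comp hmul hmaps).congr fun z hz => ?_
  simp only [Set.mem_setOf_eq] at hz
  have hz' : 0 < ((δ : ℂ) * z).im := by simpa using mul_pos (Nat.cast_pos.mpr hδ) hz
  simp only [Function.comp_apply, E2natMul, ofComplex_apply_of_im_pos hz,
    ofComplex_apply_of_im_pos hz']
  congr 1

/-- `Φ_δ` is holomorphic on `ℍ`. [folklore] -/
theorem mdifferentiable_phiE2 (δ : ℕ) (hδ : 0 < δ) : MDiff (phiE2 δ hδ) := by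
  have h : phiE2 δ hδ = fun τ => E2 τ - (δ : ℂ) * E2natMul δ hδ τ := rfl
  rw [h]
  exact E2_mdifferentiable.sub ((mdifferentiable_E2natMul δ hδ).const_smul (δ : ℂ))

/-! ### Boundedness at the cusps -/

/-- `E₂ ∣₂ A` is bounded at `i∞` for every `A ∈ SL₂(ℤ)`. [folklore] -/
theorem isBoundedAtImInfty_E2_slash (A : SL(2, ℤ)) : IsBoundedAtImInfty (E2 ∣[(2 : ℤ)] A) := by
  rw [E2_slash_action]
  refine isBoundedAtImInfty_E2.sub ?_
  -- `(2ζ(2))⁻¹ • D₂(A)(τ) = const · c/(cτ+d)` is bounded for `Im τ ≥ 1`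
  change IsBoundedAtImInfty _
  rw [UpperHalfPlane.isBoundedAtImInfty_iff]
  refine ⟨‖(1 / (2 * riemannZeta 2) : ℂ)‖ * (2 * π), 1, fun τ hτ => ?_⟩
  rw [Pi.smul_apply, smul_eq_mul, norm_mul, D2, ModularGroup.denom_apply]
  gcongr
  rcases eq_or_ne (A 1 0) 0 with hc | hc
  · simp [hc]
    positivity
  · have hcpos : 0 < ‖((A 1 0 : ℤ) : ℂ)‖ := norm_pos_iff.mpr (by exact_mod_cast hc)
    have hden : ‖((A 1 0 : ℤ) : ℂ)‖ ≤ ‖((A 1 0 : ℤ) : ℂ) * (τ : ℂ) + ((A 1 1 : ℤ) : ℂ)‖ := by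
      have him : (((A 1 0 : ℤ) : ℂ) * (τ : ℂ) + ((A 1 1 : ℤ) : ℂ)).im = (A 1 0 : ℝ) * τ.im := by
        simp [Complex.add_im, Complex.mul_im]
      calc ‖((A 1 0 : ℤ) : ℂ)‖ = |((A 1 0 : ℤ) : ℝ)| * 1 := by rw [Complex.norm_intCast, mul_one]
        _ ≤ |((A 1 0 : ℤ) : ℝ)| * τ.im := by gcongr
        _ = |(((A 1 0 : ℤ) : ℂ) * (τ : ℂ) + ((A 1 1 : ℤ) : ℂ)).im| := by
            rw [him, abs_mul, abs_of_pos τ.im_pos]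
        _ ≤ _ := Complex.abs_im_le_norm _
    have hdenpos : 0 < ‖((A 1 0 : ℤ) : ℂ) * (τ : ℂ) + ((A 1 1 : ℤ) : ℂ)‖ := lt_of_lt_of_le hcpos hden
    rw [norm_div, div_le_iff₀ hdenpos]
    have hnum : ‖(2 * π * I * ((A 1 0 : ℤ) : ℂ) : ℂ)‖ = 2 * π * ‖((A 1 0 : ℤ) : ℂ)‖ := by
      rw [norm_mul, norm_mul, norm_mul, Complex.norm_I, mul_one, Complex.norm_real, Real.norm_eq_abs,
        abs_of_pos Real.pi_pos, Complex.norm_ofNat]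
    rw [hnum]
    nlinarith [hden, Real.pi_pos]

/-- `τ ↦ E₂(δ·Aτ)·(cτ+d)⁻²` is bounded at `i∞` for every `A ∈ SL₂(ℤ)` (Hermite decomposition
`δ·Aτ = A′((gτ+m)/a′)`). [folklore] -/
theorem isBoundedAtImInfty_E2natMul_slash (δ : ℕ) (hδ : 0 < δ) (A : SL(2, ℤ)) :
    IsBoundedAtImInfty (E2natMul δ hδ ∣[(2 : ℤ)] A) := by
  obtain ⟨A', g, a', m, hg, ha', hga, -, hsmul, hden⟩ := exists_SL2_decomposition δ hδ A
  -- rewrite the slashed function through the decomposition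
  have hfun : ∀ τ : ℍ, (E2natMul δ hδ ∣[(2 : ℤ)] A) τ =
      ((a' : ℂ) ^ 2)⁻¹ * (E2 ∣[(2 : ℤ)] A') (affPt g m a' hg ha' τ) := by
    intro τ
    have hpt : natMulPt δ hδ (A • τ) = A' • affPt g m a' hg ha' τ := by
      apply UpperHalfPlane.ext
      rw [coe_natMulPt]
      exact hsmul τ
    rw [SL_slash_apply, SL_slash_apply, ModularGroup.denom_apply, ModularGroup.denom_apply, E2natMul,
      hpt, hden τ]
    have hj : (A 1 0 : ℂ) * τ + A 1 1 ≠ 0 := SL2_denom_ne_zero A τ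
    have ha0 : (a' : ℂ) ≠ 0 := by exact_mod_cast ha'.ne'
    rw [zpow_neg, zpow_neg, zpow_ofNat, zpow_ofNat, div_pow]
    field_simp
  have hB := isBoundedAtImInfty_E2_slash A'
  rw [UpperHalfPlane.isBoundedAtImInfty_iff] at hB ⊢
  obtain ⟨M, B, hM⟩ := hB
  refine ⟨‖((a' : ℂ) ^ 2)⁻¹‖ * M, max B 0 * a' / g, fun τ hτ => ?_⟩
  rw [hfun τ, norm_mul]
  gcongr
  apply hM
  rw [im_affPt]
  have hg' : (0 : ℝ) < g := Nat.cast_pos.mpr hg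
  have ha'' : (0 : ℝ) < a' := Nat.cast_pos.mpr ha'
  have h1 : max B 0 * a' / g ≤ τ.im := hτ
  rw [div_le_iff₀ hg'] at h1
  calc B ≤ max B 0 := le_max_left _ _
    _ = (g : ℝ) / a' * (max B 0 * a' / g) := by field_simp
    _ ≤ (g : ℝ) / a' * τ.im := by gcongr

/-- `Φ_δ ∣₂ A` is bounded at `i∞` for every `A ∈ SL₂(ℤ)`. [folklore] -/
theorem isBoundedAtImInfty_phiE2_slash (δ : ℕ) (hδ : 0 < δ) (A : SL(2, ℤ)) :
    IsBoundedAtImInfty (phiE2 δ hδ ∣[(2 : ℤ)] A) := by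
  have hfun : phiE2 δ hδ ∣[(2 : ℤ)] A =
      fun τ => (E2 ∣[(2 : ℤ)] A) τ - (δ : ℂ) * (E2natMul δ hδ ∣[(2 : ℤ)] A) τ := by
    funext τ
    simp only [SL_slash_apply, phiE2, E2natMul]
    ring
  rw [hfun]
  exact (isBoundedAtImInfty_E2_slash A).sub
    ((isBoundedAtImInfty_E2natMul_slash δ hδ A).const_mul_left (δ : ℂ))

/-! ### The modular form -/

/-- **`Φ_δ = E₂(τ) − δE₂(δτ) ∈ M₂(Γ₀(δ))`** (`δ ≥ 1`). [cite: DiamondShurman2005, §1.2] -/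
def phiE2ModularForm (δ : ℕ) [NeZero δ] : ModularForm (CongruenceSubgroup.Gamma0 δ) 2 where
  toFun := phiE2 δ (NeZero.pos δ)
  slash_action_eq' A hA := by
    obtain ⟨γ, hγ, rfl⟩ := hA
    exact phiE2_slash δ (NeZero.pos δ) hγ
  holo' := mdifferentiable_phiE2 δ (NeZero.pos δ)
  bdd_at_cusps' hcusp := by
    rw [Subgroup.IsArithmetic.isCusp_iff_isCusp_SL2Z] at hcusp
    rw [OnePoint.isBoundedAt_iff_forall_SL2Z hcusp]
    intro γ _
    exact isBoundedAtImInfty_phiE2_slash δ (NeZero.pos δ) γ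

/-- The underlying function. [folklore] -/
theorem coe_phiE2ModularForm (δ : ℕ) [NeZero δ] :
    (phiE2ModularForm δ : ℍ → ℂ) = phiE2 δ (NeZero.pos δ) := rfl

/-- The value at `i∞`: `Φ_δ → 1 − δ`. [folklore] -/
theorem tendsto_phiE2_atImInfty (δ : ℕ) (hδ : 0 < δ) :
    Tendsto (phiE2 δ hδ) atImInfty (𝓝 (1 - δ)) := by
  have hE : Tendsto E2 atImInfty (𝓝 1) := tendsto_E2_atImInfty
  have hmul : Tendsto (fun τ : ℍ => E2 (natMulPt δ hδ τ)) atImInfty (𝓝 1) := by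
    refine hE.comp ?_
    rw [UpperHalfPlane.atImInfty, tendsto_comap_iff]
    have : (UpperHalfPlane.im ∘ natMulPt δ hδ) = fun τ => (δ : ℝ) * τ.im := by
      funext τ
      rw [Function.comp_apply]
      change (((δ : ℂ) * (τ : ℂ))).im = _
      simp
    rw [this]
    exact Tendsto.const_mul_atTop (Nat.cast_pos.mpr hδ) tendsto_comap
  have := hE.sub (hmul.const_mul (δ : ℂ))
  rw [mul_one] at this
  exact this

end Literature.NumberTheory.ModularForms

end
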